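import Literature.Probability.RandomPlanarGeometry.SLEBubbles
import Literature.Probability.RandomPlanarGeometry.JoukowskiArcHulls
import Literature.Probability.RandomPlanarGeometry.LoewnerSemigroup
import HarnessLib

/-!
# `Ξ(κ)` has interior points: the named fact `SLEBubbles.ae_interior_nonempty` from two facts about the bubble measure

Proof companion of `Literature.Probability.RandomPlanarGeometry.SLEBubbles` ([LSW] §7.2), after

* G. F. Lawler, O. Schramm, W. Werner, *Conformal restriction: the chordal case*, J. Amer. Math.
  Soc. **16** (2003) 917–955, arXiv:math/0209343 (**[LSW]**), §7.1 (p. 27): the bubble measure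
  is "a σ-finite but infinite measure"; §7.2 (p. 28): `X̂ = {g_t⁻¹(K + W_t) : (K, t) ∈ X}`,
  `Ξ(κ) = F^ℝ_ℍ(γ(0, ∞) ∪ ⋃ X̂)`.

The fact `SLEBubbles.ae_interior_nonempty` ("for `0 < κ < 8/3` almost surely `Ξ(κ)` has an
interior point") bundles a measure-theoretic argument with two properties of the Brownian bubble
measure `μ`. Here the argument is PROVED and the two properties are isolated:

* `Literature.Probability.RandomPlanarGeometry.IsBrownianBubbleMeasure.measure_univ_eq_top` —
  NAMED FACT ([LSW] §7.1): `μ` is an infinite measure;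
* `IsBrownianBubbleMeasure.ae_interior_nonempty` (`BrownianBubbles`, folklore): `μ`-a.e. bubble
  has an interior point;

and `Literature.Probability.RandomPlanarGeometry.SLEBubbles.ae_interior_nonempty_of_facts`
derives the bundled fact from them: the mean measure `λ_κ μ ⊗ dt` has infinite mass (`λ_κ > 0`,
`μ(Ω_b) = ∞`, `dt[0, ∞) = ∞`), so the cloud is a.s. nonempty
(`IsPoissonCloud.ae_nonempty_of_measure_univ`); the bubbles without interior points lie in a
`μ`-null measurable set `N`, `N × [0, ∞)` is null for the mean measure, so a.s. no point of the
cloud lies in it (`IsPoissonCloud.measure_inter_eq_empty`); and for a bubble `K` with an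
interior point, `g_t⁻¹(int K + W_t)` is a nonempty open subset of `Ξ(κ)`
(`interior_attachedBubble_nonempty`: `g_t⁻¹` maps `ℍ` bijectively onto the open set `H_t` with
continuous inverse `g_t`, the tree's `Loewner.loewnerInv`, `Loewner.bijOn_map`,
`Loewner.isOpen_domain`).

Mathlib: `Measure.QuasiMeasurePreserving.ae` with `quasiMeasurePreserving_snd`,
`exists_measurable_superset_of_null`, `ContinuousOn.isOpen_inter_preimage`, `isOpenMap_add_right`.

## The bubble measure is infinite — `IsBrownianBubbleMeasure.measure_univ_eq_top` PROVED

[LSW] §7.1 (p. 27) calls the bubble measure "σ-finite but infinite", and p. 28 records the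
scaling "if `r_λ(K) = λK`, then `r_λ ∘ μ = λ² μ`". Through (7.2) this is elementary:

* `Literature.Probability.RandomPlanarGeometry.HasRestrictionJet.smulHull` — if
  `Φ_A(z) = d z + c₂ z² + c₃ z³ + o(z³)` then the restriction map `Φ_{rA}(z) = r Φ_A(z/r)` of the
  dilated hull (`ConformalEquiv.smulHull`, `IsRestrictionMap.smulHull` of `LoewnerSemigroup`) has
  the jet `(d, c₂/r, c₃/r²)`, so `bubbleMass` scales like `r⁻²` (`bubbleMass_div_pow`);
* `Literature.Probability.RandomPlanarGeometry.hasRestrictionJet_joukowskiArcMap` — ONE explicit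
  jet: the restriction map `Φ_{p,q} = a⁻¹ J⁻¹(a J + b)` of the arc hulls `circArcHull p q` on the
  unit circle (`JoukowskiArcHulls`, [LSW] Rem. 3.7; `a = 4/(q − p)`, `b = −2 − ap`) has
  `Φ_{p,q}(z) = a⁻² z − b a⁻³ z² + (b² − a² + 1) a⁻⁴ z³ + o(z³)`, from the functional equation
  `u (a z² + b z + a − u z) = z` of its inner branch (`arcInner_mul_eq`); hence
  `−SΦ_{p,q}(0)/6 = 1 − a⁻² = 1 − Φ'_{p,q}(0)` (`bubbleMass_arcJet`), `= 3/4` for the quarter arc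
  `{e^{iθ} : θ ∈ [π/2, π]} = circArcHull 0 2` of Rem. 3.7 (`Φ'(0) = 1/4`);
* so a Brownian bubble measure gives mass `(3/4) r⁻²` to the bubbles hitting the quarter arc of
  radius `r` (`IsBrownianBubbleMeasure.measure_hit_smul_quarterArc`), for every `r > 0`:
  `μ(Ω_b) = ∞` (`IsBrownianBubbleMeasure.measure_univ_eq_top_holds`), and
  `SLEBubbles.ae_interior_nonempty` needs only the interior property of the bubbles
  (`SLEBubbles.ae_interior_nonempty_of_ae_interior_nonempty`).
-/

noncomputable section

open Set Filter Topology MeasureTheory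
open UpperHalfPlane (upperHalfPlaneSet isOpen_upperHalfPlaneSet)
open scoped NNReal ENNReal
open Literature.Probability.Process (preWienerMeasure IsPoissonCloud)

namespace Literature.Probability.RandomPlanarGeometry

/-! ### The bubble measure is infinite ([LSW] §7.1) -/

/-- NAMED FACT — **the Brownian bubble measure is infinite** ([LSW] §7.1, p. 27: `ν` is "a
σ-finite but infinite measure", `μ` its image under `z ↦ −1/z`; equivalently, from (7.2) and
the scaling `r_λ ∘ μ = λ² μ` of p. 28, `μ[K ∩ λA ≠ ∅] = λ⁻² μ[K ∩ A ≠ ∅] → ∞` as `λ ↓ 0`):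
`μ(Ω_b) = ∞` for every Brownian bubble measure. [cite: LawlerSchrammWerner2003Restriction, §7.1 (pp. 27–28)] -/
def IsBrownianBubbleMeasure.measure_univ_eq_top : Prop :=
  ∀ {μ : Measure BubbleConfig}, IsBrownianBubbleMeasure μ → μ univ = ∞

/-! ### The mean measure `λ_κ μ ⊗ dt` -/

/-- `dt[0, ∞) = ∞`. [folklore] -/
theorem timeMeasure_univ : timeMeasure univ = ∞ := by
  rw [timeMeasure, Measure.map_apply measurable_real_toNNReal MeasurableSet.univ, preimage_univ,
    Measure.restrict_apply MeasurableSet.univ, univ_inter]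
  exact Real.volume_Ici

/-- The time measure is s-finite. [folklore] -/
instance sFinite_timeMeasure : SFinite timeMeasure := by
  unfold timeMeasure
  infer_instance

/-- **The mean measure of the bubble cloud is infinite** as soon as `λ_κ ≠ 0` and `μ ≠ 0`
(`dt[0, ∞) = ∞`). [folklore] -/
theorem bubbleCloudIntensity_univ {κ : ℝ≥0} (hκ : sleBubbleIntensity κ ≠ 0)
    {μ : Measure BubbleConfig} (hμ : μ univ ≠ 0) : bubbleCloudIntensity κ μ univ = ∞ := by
  rw [bubbleCloudIntensity, Measure.smul_apply, ← univ_prod_univ, Measure.prod_prod, timeMeasure_univ,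
    ENNReal.mul_top hμ, smul_eq_mul, ENNReal.mul_top hκ]

/-- A `μ`-null set of bubbles, times all times, is null for the mean measure. [folklore] -/
theorem bubbleCloudIntensity_prod_univ_eq_zero (κ : ℝ≥0) {μ : Measure BubbleConfig}
    {N : Set BubbleConfig} (hN : μ N = 0) :
    bubbleCloudIntensity κ μ (N ×ˢ (univ : Set ℝ≥0)) = 0 := by
  rw [bubbleCloudIntensity, Measure.smul_apply, smul_eq_mul, Measure.prod_prod, hN, zero_mul,
    mul_zero]

/-- `λ_κ ≠ 0` for `0 < κ < 8/3`. [folklore] -/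
theorem sleBubbleIntensity_ne_zero {κ : ℝ≥0} (h0 : 0 < κ) (h : κ < 8 / 3) : sleBubbleIntensity κ ≠ 0 := by
  rw [sleBubbleIntensity, ne_eq, ENNReal.ofReal_eq_zero, not_le]
  exact sleBubbleIntensityReal_pos h0 h

/-! ### Attached bubbles have interior points -/

section Attached

variable {W : ℝ≥0 → ℝ}

/-- **`g_t⁻¹` is an open map on `ℍ`**: for an open `O ⊆ ℍ`, `g_t⁻¹(O) = H_t ∩ g_t⁻¹'(O)` is open
(`g_t : H_t → ℍ` is a continuous bijection of the open set `H_t` onto `ℍ` with inverse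
`Loewner.loewnerInv`). [folklore] -/
theorem Loewner.isOpen_image_loewnerInv (hW : Continuous W) (t : ℝ≥0) {O : Set ℂ} (hO : IsOpen O)
    (hOH : O ⊆ upperHalfPlaneSet) : IsOpen (Loewner.loewnerInv W t '' O) := by
  have heq : Loewner.loewnerInv W t '' O = Loewner.domain W t ∩ Loewner.map W t ⁻¹' O := by
    ext w
    constructor
    · rintro ⟨z, hz, rfl⟩
      exact ⟨Loewner.loewnerInv_mem_domain hW t (hOH hz), by
        rw [mem_preimage, Loewner.map_loewnerInv hW t (hOH hz)]; exact hz⟩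
    · rintro ⟨hw, hwO⟩
      exact ⟨Loewner.map W t w, hwO, Loewner.loewnerInv_map hW hw⟩
  rw [heq]
  exact (Loewner.differentiableOn_map hW t).continuousOn.isOpen_inter_preimage
    (Loewner.isOpen_domain hW t) hO

/-- **An attached bubble `g_t⁻¹(K + W_t)` has an interior point when `K ⊆ ℍ` has one**: it
contains the nonempty open set `g_t⁻¹(int K + W_t)`. [folklore] -/
theorem interior_attachedBubble_nonempty (κ : ℝ≥0) (ω : ℝ≥0 → ℝ) {K : Set ℂ}
    (hK : K ⊆ upperHalfPlaneSet) (hint : (interior K).Nonempty) (t : ℝ≥0) :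
    (interior (attachedBubble κ ω K t)).Nonempty := by
  set c : ℂ := (sleDriving κ ω t : ℂ)
  set O : Set ℂ := (fun z ↦ z + c) '' interior K with hO
  have hOopen : IsOpen O := (isOpenMap_add_right c) _ isOpen_interior
  have hOH : O ⊆ upperHalfPlaneSet := by
    rintro _ ⟨z, hz, rfl⟩
    show 0 < (z + c).im
    have : 0 < z.im := hK (interior_subset hz)
    simpa [c] using this
  have hOsub : Loewner.loewnerInv (sleDriving κ ω) t '' O ⊆ attachedBubble κ ω K t :=
    image_mono (image_mono interior_subset)
  have hopen := Loewner.isOpen_image_loewnerInv (continuous_sleDriving κ ω) t hOopen hOH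
  obtain ⟨z, hz⟩ := hint
  refine ⟨Loewner.loewnerInv (sleDriving κ ω) t (z + c), ?_⟩
  exact interior_maximal hOsub hopen ⟨z + c, ⟨z, hz, rfl⟩, rfl⟩

/-- An attached bubble of a bubble `K ∈ Ω_b` lies in `ℍ` (`K + W_t ⊆ ℍ` and `g_t⁻¹(ℍ) = H_t ⊆ ℍ`).
[folklore] -/
theorem attachedBubble_subset_upperHalfPlaneSet (κ : ℝ≥0) (ω : ℝ≥0 → ℝ) {K : Set ℂ}
    (hK : K ⊆ upperHalfPlaneSet) (t : ℝ≥0) : attachedBubble κ ω K t ⊆ upperHalfPlaneSet := by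
  rintro _ ⟨_, ⟨z, hz, rfl⟩, rfl⟩
  refine Loewner.domain_subset _ t (Loewner.loewnerInv_mem_domain (continuous_sleDriving κ ω) t ?_)
  show 0 < (z + (sleDriving κ ω t : ℂ)).im
  simpa using (hK hz : 0 < z.im)

end Attached

/-! ### The bundled fact from the two facts about `μ` -/

/-- **`SLEBubbles.ae_interior_nonempty` from the two facts about the bubble measure**
(`h₁`: `μ`-a.e. bubble has an interior point; `h₂`: `μ` is infinite): for `0 < κ < 8/3`, a
Brownian bubble measure `μ` and an independent Poisson cloud `X` with mean `λ_κ μ ⊗ dt`, almost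
surely `Ξ(κ)` has an interior point. [cite: LawlerSchrammWerner2003Restriction, §7.2 (p. 28) with §7.1 (p. 27)] -/
theorem SLEBubbles.ae_interior_nonempty_of_facts
    (h₁ : IsBrownianBubbleMeasure.ae_interior_nonempty)
    (h₂ : IsBrownianBubbleMeasure.measure_univ_eq_top) : SLEBubbles.ae_interior_nonempty := by
  intro κ hκ0 hκ μ hμ Ω' _ P' X hX
  haveI : IsProbabilityMeasure P' := hX.isProbabilityMeasure
  haveI : IsProbabilityMeasure preWienerMeasure := isProbabilityMeasure_preWienerMeasure'
  -- the bubbles without interior points lie in a null measurable set `N`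
  obtain ⟨N, hNsub, hNmeas, hN0⟩ :=
    exists_measurable_superset_of_null (s := {K : BubbleConfig | ¬ (interior (K : Set ℂ)).Nonempty})
      (ae_iff.1 (h₁ hμ))
  set s : Set (BubbleConfig × ℝ≥0) := N ×ˢ univ with hs
  have hsmeas : MeasurableSet s := hNmeas.prod MeasurableSet.univ
  have hΛs : bubbleCloudIntensity κ μ s = 0 := bubbleCloudIntensity_prod_univ_eq_zero κ hN0
  -- a.s. no point of the cloud lies in `s`
  have havoid : ∀ᵐ ω' ∂P', X ω' ∩ s = ∅ := by
    have hmeas : MeasurableSet {ω' | X ω' ∩ s = ∅} := hX.measurableSet_inter_eq_empty hsmeas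
    have hone : P' {ω' | X ω' ∩ s = ∅} = 1 := by
      rw [hX.measure_inter_eq_empty hsmeas (by rw [hΛs]; exact ENNReal.zero_ne_top), hΛs]
      simp
    rw [ae_iff]
    exact (prob_compl_eq_zero_iff hmeas).2 hone
  -- a.s. the cloud is nonempty: its mean measure is infinite
  have hne : ∀ᵐ ω' ∂P', (X ω').Nonempty :=
    hX.ae_nonempty_of_measure_univ (bubbleCloudIntensity_univ (sleBubbleIntensity_ne_zero hκ0 hκ)
      (by rw [h₂ hμ]; exact ENNReal.top_ne_zero))
  -- lift to the product space
  have hprod : ∀ᵐ p ∂(preWienerMeasure.prod P'), (X p.2).Nonempty ∧ X p.2 ∩ s = ∅ :=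
    (Measure.quasiMeasurePreserving_snd (μ := preWienerMeasure) (ν := P')).ae (hne.and havoid)
  filter_upwards [hprod] with p hp
  obtain ⟨⟨q, hq⟩, hXs⟩ := hp
  -- the bubble `q.1` has an interior point
  have hqN : q.1 ∉ N := fun h ↦ by
    have : q ∈ X p.2 ∩ s := ⟨hq, ⟨h, mem_univ _⟩⟩
    rw [hXs] at this
    exact this
  have hint : (interior ((q.1 : BubbleConfig) : Set ℂ)).Nonempty := by
    by_contra h
    exact hqN (hNsub h)
  -- hence so does its attached bubble, a subset of `Ξ`
  obtain ⟨z, hz⟩ := interior_attachedBubble_nonempty κ p.1 q.1.subset_upperHalfPlaneSet hint q.2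
  refine ⟨z, interior_mono ?_ hz⟩
  intro w hw
  refine attachedBubble_inter_subset_sleBubbleSet κ p.1 hq ⟨hw, ?_⟩
  exact le_of_lt (show 0 < w.im from
    attachedBubble_subset_upperHalfPlaneSet κ p.1 q.1.subset_upperHalfPlaneSet q.2 hw)

/-! ### Jets under dilation -/

section Smul

open scoped Pointwise

variable {A : Set ℂ} {Φ : ConformalEquiv (upperHalfPlaneSet \ A) upperHalfPlaneSet} {r : ℝ}

/-- **Jets under dilation**: if `Φ_A(z) = d z + c₂ z² + c₃ z³ + o(z³)` in `ℍ ∖ A`, then the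
restriction map `Φ_{rA}(z) = r Φ_A(z/r)` of `rA` (`ConformalEquiv.smulHull`) satisfies
`Φ_{rA}(z) = d z + (c₂/r) z² + (c₃/r²) z³ + o(z³)` in `ℍ ∖ rA` (this is the scaling
`r_λ ∘ μ = λ² μ` of [LSW] p. 28 read through (7.2)). [folklore] -/
theorem HasRestrictionJet.smulHull (hr : 0 < r) {d c₂ c₃ : ℝ} (h : HasRestrictionJet A Φ d c₂ c₃) :
    HasRestrictionJet (r • A) (Φ.smulHull r hr) d (c₂ / r) (c₃ / r ^ 2) := by
  unfold HasRestrictionJet at h ⊢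
  have h1 := (h.comp (tendsto_inv_smul_nhdsWithin_diff hr)).const_mul (((r : ℂ) ^ 2)⁻¹)
  rw [mul_zero] at h1
  refine h1.congr' ?_
  filter_upwards [self_mem_nhdsWithin] with z hz
  have hz0 : z ≠ 0 := ne_zero_of_mem_diff hz
  have hr' : (r : ℂ) ≠ 0 := by exact_mod_cast hr.ne'
  simp only [Function.comp_apply, ConformalEquiv.smulHull_apply, Complex.real_smul]
  push_cast
  field_simp

end Smul

/-- **`bubbleMass` scales like `r⁻²`** under the dilation `z ↦ rz` of the hull. [folklore] -/
theorem bubbleMass_div_pow (d c₂ c₃ : ℝ) {r : ℝ} (hr : r ≠ 0) :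
    bubbleMass d (c₂ / r) (c₃ / r ^ 2) = bubbleMass d c₂ c₃ / r ^ 2 := by
  unfold bubbleMass
  by_cases hd : d = 0
  · subst hd
    simp
  · field_simp

/-- `bubbleMass` of a jet of the shape `(a⁻², −b a⁻³, (b² − a² + 1) a⁻⁴)` is `1 − a⁻²`. [folklore] -/
theorem bubbleMass_arcJet {a : ℝ} (ha : a ≠ 0) (b : ℝ) :
    bubbleMass (a⁻¹ ^ 2) (-(b * a⁻¹ ^ 3)) ((b ^ 2 - a ^ 2 + 1) * a⁻¹ ^ 4) = 1 - a⁻¹ ^ 2 := by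
  unfold bubbleMass
  field_simp
  ring

/-! ### The jet of the arc hulls `circArcHull p q` -/

section ArcJet

variable {p q : ℝ}

/-- **The jet of `Φ_{p,q}` at `0`.** With `a = 4/(q − p)` and `b = −2 − ap` (`arcScale`,
`arcShift`), the restriction map `Φ_{p,q} = a⁻¹ u` of `circArcHull p q`, whose inner branch
satisfies the functional equation `u · (a z² + b z + a − u z) = z` (`arcInner_mul_eq`), has
`Φ_{p,q}(z) = a⁻² z − b a⁻³ z² + (b² − a² + 1) a⁻⁴ z³ + o(z³)` in `ℍ ∖ circArcHull p q`: with
`D = a z² + b z + a − u z → a` and `u = z/D`, the remainder is `a⁻¹ E`,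
`E = (a u/z − a² + a b z + b² − b u)/(a² D) − (b² − a² + 1)/a³ → 0` (`u → 0`, `u/z = 1/D → 1/a`).
[folklore] -/
theorem hasRestrictionJet_joukowskiArcMap (hp : -2 ≤ p) (hpq : p < q) (hq : q ≤ 2) :
    HasRestrictionJet (circArcHull p q) (joukowskiArcMap hp hpq hq)
      ((arcScale p q)⁻¹ ^ 2) (-(arcShift p q * (arcScale p q)⁻¹ ^ 3))
      ((arcShift p q ^ 2 - arcScale p q ^ 2 + 1) * (arcScale p q)⁻¹ ^ 4) := by
  set U := upperHalfPlaneSet \ circArcHull p q with hU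
  have ha := arcScale_ne_zero hpq
  -- the denominator `D z = a z² + b z + a − u z · z → a` (as in `isRestrictionMap_joukowskiArcMap`)
  have hsmall : ∀ᶠ z in 𝓝[U] 0, z ∈ U ∧ ‖z‖ < 1 := by
    filter_upwards [self_mem_nhdsWithin, nhdsWithin_le_nhds (Metric.ball_mem_nhds (0 : ℂ) one_pos)]
      with z hz hz1
    exact ⟨hz, by simpa using hz1⟩
  have hT1 : Tendsto (fun z ↦ arcInner p q z * z) (𝓝[U] 0) (𝓝 0) := by
    refine squeeze_zero_norm' ?_ ((tendsto_norm_zero).mono_left nhdsWithin_le_nhds)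
    filter_upwards [hsmall] with z ⟨hz, hz1⟩
    rw [norm_mul]
    calc ‖arcInner p q z‖ * ‖z‖ ≤ 1 * ‖z‖ := by
          gcongr
          exact (norm_arcInner_lt_one hpq hz hz1).le
      _ = ‖z‖ := one_mul _
  set D : ℂ → ℂ := fun z ↦ (arcScale p q : ℂ) * z ^ 2 + arcShift p q * z + arcScale p q -
    arcInner p q z * z with hD
  have hDt : Tendsto D (𝓝[U] 0) (𝓝 (arcScale p q)) := by
    have h1 : Tendsto (fun z : ℂ ↦ (arcScale p q : ℂ) * z ^ 2 + arcShift p q * z + arcScale p q) (𝓝[U] 0)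
        (𝓝 ((arcScale p q : ℂ) * 0 ^ 2 + arcShift p q * 0 + arcScale p q)) :=
      (Continuous.tendsto (by fun_prop) 0).mono_left nhdsWithin_le_nhds
    have h2 := h1.sub hT1
    simp only [ne_eq, OfNat.ofNat_ne_zero, not_false_eq_true, zero_pow, mul_zero, zero_add,
      sub_zero] at h2
    exact h2
  have hDne : ∀ z ∈ U, D z ≠ 0 := fun z hz hD0 ↦ by
    have h := arcInner_mul_eq hpq hz
    rw [show (arcScale p q : ℂ) * z ^ 2 + arcShift p q * z + arcScale p q - arcInner p q z * z = D z
      from rfl, hD0, mul_zero] at h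
    exact (UpperHalfPlane.ne_zero ⟨_, hz.1⟩) h.symm
  have hueq : ∀ z ∈ U, arcInner p q z = z / D z := fun z hz ↦ by
    rw [eq_div_iff (hDne z hz)]
    exact arcInner_mul_eq hpq hz
  -- `z → 0`, `u → 0` and `u/z = 1/D → 1/a`
  have hz0t : Tendsto (fun z : ℂ ↦ z) (𝓝[U] 0) (𝓝 0) := tendsto_id.mono_left nhdsWithin_le_nhds
  have hu : Tendsto (arcInner p q) (𝓝[U] 0) (𝓝 0) := by
    have h1 := hz0t.div hDt ha
    rw [zero_div] at h1
    refine h1.congr' ?_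
    filter_upwards [self_mem_nhdsWithin] with z hz
    exact (hueq z hz).symm
  have hudiv : Tendsto (fun z ↦ arcInner p q z / z) (𝓝[U] 0) (𝓝 (arcScale p q : ℂ)⁻¹) := by
    refine (hDt.inv₀ ha).congr' ?_
    filter_upwards [self_mem_nhdsWithin] with z hz
    have hz0 : z ≠ 0 := UpperHalfPlane.ne_zero ⟨_, hz.1⟩
    have hDz := hDne z hz
    rw [hueq z hz]
    field_simp
  -- the normalised remainder `E → 0`
  set E : ℂ → ℂ := fun z ↦
    ((arcScale p q : ℂ) * (arcInner p q z / z) - (arcScale p q : ℂ) ^ 2 +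
          (arcScale p q : ℂ) * arcShift p q * z + (arcShift p q : ℂ) ^ 2 - arcShift p q * arcInner p q z) /
        ((arcScale p q : ℂ) ^ 2 * D z) -
      ((arcShift p q : ℂ) ^ 2 - (arcScale p q : ℂ) ^ 2 + 1) * (arcScale p q : ℂ)⁻¹ ^ 3 with hE
  have hEt : Tendsto E (𝓝[U] 0) (𝓝 0) := by
    have h1 := ((((hudiv.const_mul (arcScale p q : ℂ)).sub
      (tendsto_const_nhds (x := (arcScale p q : ℂ) ^ 2))).add
      (hz0t.const_mul ((arcScale p q : ℂ) * arcShift p q))).add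
      (tendsto_const_nhds (x := (arcShift p q : ℂ) ^ 2))).sub (hu.const_mul (arcShift p q : ℂ))
    have h2 := (h1.div (hDt.const_mul ((arcScale p q : ℂ) ^ 2)) (mul_ne_zero (pow_ne_zero 2 ha) ha)).sub
      (tendsto_const_nhds (x := ((arcShift p q : ℂ) ^ 2 - (arcScale p q : ℂ) ^ 2 + 1) * (arcScale p q : ℂ)⁻¹ ^ 3))
    have hval : ((arcScale p q : ℂ) * (arcScale p q : ℂ)⁻¹ - (arcScale p q : ℂ) ^ 2 +
        (arcScale p q : ℂ) * arcShift p q * 0 + (arcShift p q : ℂ) ^ 2 - arcShift p q * 0) /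
          ((arcScale p q : ℂ) ^ 2 * arcScale p q) -
        ((arcShift p q : ℂ) ^ 2 - (arcScale p q : ℂ) ^ 2 + 1) * (arcScale p q : ℂ)⁻¹ ^ 3 = 0 := by
      field_simp
      ring
    rw [hval] at h2
    exact h2
  unfold HasRestrictionJet
  have hfin := hEt.const_mul (arcScale p q : ℂ)⁻¹
  rw [mul_zero] at hfin
  refine hfin.congr' ?_
  filter_upwards [self_mem_nhdsWithin] with z hz
  have hz0 : z ≠ 0 := UpperHalfPlane.ne_zero ⟨_, hz.1⟩
  -- everything explicit in the atoms `u = arcInner p q z`, `z`, `a`, `b`; then `w = D z`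
  simp only [hE, hD, joukowskiArcMap_apply, joukowskiArcFun_eq]
  have hmul : arcInner p q z * ((arcScale p q : ℂ) * z ^ 2 + arcShift p q * z + arcScale p q -
      arcInner p q z * z) = z := arcInner_mul_eq hpq hz
  have hDz : (arcScale p q : ℂ) * z ^ 2 + arcShift p q * z + arcScale p q - arcInner p q z * z ≠ 0 :=
    hDne z hz
  generalize hw : (arcScale p q : ℂ) * z ^ 2 + arcShift p q * z + arcScale p q - arcInner p q z * z = w
    at hmul hDz ⊢
  push_cast
  -- `L − R = −(u w − z)/(a w z³)` once `w = a z² + b z + a − u z` is substituted back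
  linear_combination (norm := skip) (-(1 : ℂ) / ((arcScale p q : ℂ) * w * z ^ 3)) * hmul
  field_simp
  rw [← hw]
  ring

end ArcJet

/-! ### The bubble measure is infinite ([LSW] §7.1): `IsBrownianBubbleMeasure.measure_univ_eq_top` PROVED -/

section Mass

open scoped Pointwise

/-- **The hitting mass of the dilated quarter arc**: for a Brownian bubble measure `μ` and
`r > 0`, `μ[K ∩ rA ≠ ∅] = (3/4) r⁻²` for the quarter arc `A = circArcHull 0 2 = {e^{iθ} : θ ∈ [π/2, π]}`
of [LSW] Rem. 3.7 (`Φ'_A(0) = 1/4`, `−SΦ_A(0)/6 = 1 − 1/4`), by (7.2) for the dilated hull `rA`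
(`IsStarHull.smul`, `IsRestrictionMap.smulHull`, `HasRestrictionJet.smulHull`).
[cite: LawlerSchrammWerner2003Restriction, §7.1 eq. (7.2) (p. 28) with Rem. 3.7 (p. 13)] -/
theorem IsBrownianBubbleMeasure.measure_hit_smul_quarterArc {μ : Measure BubbleConfig}
    (hμ : IsBrownianBubbleMeasure μ) {r : ℝ} (hr : 0 < r) :
    μ (BubbleConfig.hit (r • circArcHull 0 2)) = ENNReal.ofReal (3 / 4 / r ^ 2) := by
  have hp : (-2 : ℝ) ≤ 0 := by norm_num
  have hpq : (0 : ℝ) < 2 := by norm_num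
  have hq : (2 : ℝ) ≤ 2 := le_rfl
  rw [hμ ((isStarHull_circArcHull hp hpq hq).smul hr) ((isRestrictionMap_joukowskiArcMap hp hpq hq).smulHull hr)
    ((hasRestrictionJet_joukowskiArcMap hp hpq hq).smulHull hr), bubbleMass_div_pow _ _ _ hr.ne',
    bubbleMass_arcJet (arcScale_pos hpq).ne']
  congr 1
  rw [arcScale]
  norm_num

/-- **`IsBrownianBubbleMeasure.measure_univ_eq_top` holds**: a Brownian bubble measure is
infinite — by (7.2) and the dilation covariance of jets it gives mass `(3/4) r⁻²` to the bubbles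
hitting the quarter arc of radius `r`, for every `r > 0` ([LSW] §7.1, p. 27: `ν` is "a σ-finite
but infinite measure"; p. 28: "`r_λ ∘ μ = λ² μ`"). [cite: LawlerSchrammWerner2003Restriction, §7.1 (pp. 27–28)] -/
theorem IsBrownianBubbleMeasure.measure_univ_eq_top_holds : IsBrownianBubbleMeasure.measure_univ_eq_top := by
  intro μ hμ
  refine ENNReal.eq_top_of_forall_nnreal_le fun c ↦ ?_
  -- radius `r = 1/(c + 1)`: mass `(3/4)(c + 1)² ≥ c`
  have hr : (0 : ℝ) < 1 / ((c : ℝ) + 1) := by positivity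
  calc (c : ℝ≥0∞) = ENNReal.ofReal c := ENNReal.ofReal_coe_nnreal.symm
    _ ≤ ENNReal.ofReal (3 / 4 / (1 / ((c : ℝ) + 1)) ^ 2) := by
        refine ENNReal.ofReal_le_ofReal ?_
        rw [one_div, inv_pow, div_inv_eq_mul]
        nlinarith [c.coe_nonneg, sq_nonneg ((c : ℝ) - 1)]
    _ = μ (BubbleConfig.hit ((1 / ((c : ℝ) + 1)) • circArcHull 0 2)) :=
        (hμ.measure_hit_smul_quarterArc hr).symm
    _ ≤ μ univ := measure_mono (subset_univ _)

/-- **`SLEBubbles.ae_interior_nonempty` from the one remaining fact about `μ`** (bubbles have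
interior points `μ`-a.e., `IsBrownianBubbleMeasure.ae_interior_nonempty`), `μ(Ω_b) = ∞` being
proved (`IsBrownianBubbleMeasure.measure_univ_eq_top_holds`).
[cite: LawlerSchrammWerner2003Restriction, §7.2 (p. 28) with §7.1 (p. 27)] -/
theorem SLEBubbles.ae_interior_nonempty_of_ae_interior_nonempty
    (h₁ : IsBrownianBubbleMeasure.ae_interior_nonempty) : SLEBubbles.ae_interior_nonempty :=
  SLEBubbles.ae_interior_nonempty_of_facts h₁ IsBrownianBubbleMeasure.measure_univ_eq_top_holds

end Mass

end Literature.Probability.RandomPlanarGeometry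

end
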